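import Summits.BirchSwinnertonDyer.Rank1Residual.GaloisImage.FiniteSingularComparisonOperator
import Literature.NumberTheory.GaloisRepresentations.FrobeniusQuotientHOne
import HarnessLib

/-!
# The canonical finite–singular comparison map is an isomorphism, III: injectivity of `φ^{fs}`
# on `H¹_ur(F, M)` (local, prime modulus)
# (cell `b2b-bsdres`, team n1011, seat p11 gen 4, OWNERS row T-HCC-adm; file 3/5)

HONEST FRAMING (cell `b2b-bsdres`, run/shared/lean/b2b/bsd-rank1-residual/, verbatim in every
file): the goal of the cell is to DELETE the COMBINATION-SHAPED residual classes of the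
Birch–Swinnerton-Dyer formula for ALL analytic-rank `≤ 1` elliptic curves over `ℚ` — "full BSD
formula for every rank `≤ 1` curve in class `C`" assembled STRICTLY from published theorems — so
that the rank-`≤ 1` remainder becomes exactly the CONSTRUCTION-SHAPED classes, which are TYPED
(missing-input `Prop`s), NOT attempted. This is not "finishing BSD". Team n1011 (N10 / N11, the
additive block X4 ∧ `p = 3`): research route on the CONSTRUCTION-SHAPED class X4; no claim beyond the
stated classes; nothing is booked. TOOL theorems of local Galois cohomology; no definition, no named
fact, no `sorry`.

## What is proved (`F` a non-archimedean local field, `M` a finite unramified discrete `Γ_F`-module)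

* `FSComp.oneCocycleClass_eq_zero_of_apply_frob_eq` — the injectivity half of Rubin PCMI
  Prop. 1.4.13 (1) (`H¹_ur(F, M) ≅ M/(φ − 1)M` by evaluation at a Frobenius): a continuous cocycle
  `z` vanishing on the inertia group with `z(φ) = φ m − m` for an arithmetic Frobenius `φ` is a
  coboundary.  (`z − ∂m` vanishes on the open normal subgroup `U = {g : ρ g = 1, (z − ∂m)(g) = 0}`
  containing `I_F` and at `φ`; Frobenius generates `Γ_F/U` — tree `exists_pow_eq_mk` — so it
  vanishes, tree `contOneCocycles.eq_zero_of_apply_eq_zero`.)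
* `FSComp.injective_fs_of_isFiniteSingularComparisonWith` — **for `M` free over `𝔽_p` with
  `M/(φ − 1)M ≃ ℤ/p`, a comparison map `fs` satisfying the tree predicate
  `IsFiniteSingularComparisonWith ρ p fs φ τ` (n1011-lit; n1011-p04's canonical map satisfies it) is
  INJECTIVE on `H¹_ur(F, M)`**: `fs [z] = 0` gives (with the representative `w = 0`)
  `Q(φ⁻¹)·z(φ) = 0`, so `z(φ) ∈ (φ − 1)M` by file 2, so `[z] = 0` by the first theorem.  This is the
  injectivity in [MR04] Lemma 1.2.3 / Rubin Ex. 1.9.7 ("`φ^{fs}` is an isomorphism"); surjectivity is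
  obtained globally by counting in file 4.

References: B. Mazur, K. Rubin, Mem. AMS 799 (2004) Lemma 1.2.1, Def. 1.2.2, Lemma 1.2.3; K. Rubin,
PCMI 18 (2011) Prop. 1.4.13 (1), Def. 1.9.6, Ex. 1.9.7; J.-P. Serre, *Local Fields*, XIII §1.
-/

noncomputable section

open Field Polynomial Module
open Literature.NumberTheory.GaloisRepresentations
open Literature.NumberTheory.GaloisRepresentations.DiscreteGaloisModule
open scoped ContRepresentation Polynomial

universe u

namespace Summit.BirchSwinnertonDyer.Rank1Residual.GaloisImage.FSComp

section Local

variable {F : Type u} [Field F] [ValuativeRel F] [TopologicalSpace F] [IsNonarchimedeanLocalField F]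
variable {M : Type u} [AddCommGroup M] [TopologicalSpace M] [DiscreteTopology M] [Finite M]
variable (ρ : DiscreteGaloisModule F M)

/-- **A cocycle of a finite unramified module vanishing on inertia and at an arithmetic Frobenius
vanishes identically** (Frobenius generates `Γ_F` modulo any open normal subgroup containing the
inertia group: tree `exists_pow_eq_mk`). [cite: Rubin2011, Prop. 1.4.13 (1) (p. 9)]
[cite: SerreLocalFields1979, XIII §1 Prop. 1] -/
theorem cocycle_eq_zero_of_apply_frob_eq_zero (hI : ∀ τ ∈ absInertia F, ρ τ = 1)
    {φ : absoluteGaloisGroup F} (hφ : IsAbsArithFrob φ) (w : contOneCocycles ρ.toTopRep)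
    (hw : ∀ τ ∈ absInertia F, w.1 τ = 0) (hwφ : w.1 φ = 0) : w = 0 := by
  -- the open normal subgroup `U = {g : ρ g = 1 ∧ w g = 0}`
  have hcoc : ∀ a b, w.1 (a * b) = w.1 a + ρ a (w.1 b) := fun a b => w.2 a b
  have h1 : w.1 1 = 0 := contOneCocycles.apply_one w
  let U : Subgroup (absoluteGaloisGroup F) :=
    { carrier := {g | ρ g = 1 ∧ w.1 g = 0}
      mul_mem' := fun {a b} ha hb => by
        refine ⟨by rw [map_mul, ha.1, hb.1, mul_one], ?_⟩
        rw [hcoc, ha.2, hb.2, map_zero, add_zero]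
      one_mem' := ⟨map_one ρ, h1⟩
      inv_mem' := fun {a} ha => by
        have hinv : ρ a⁻¹ = 1 := by
          have h := map_mul ρ a⁻¹ a
          rw [inv_mul_cancel, map_one, ha.1, mul_one] at h
          exact h.symm
        refine ⟨hinv, ?_⟩
        have h := hcoc a⁻¹ a
        rw [inv_mul_cancel, h1, ha.2, map_zero, add_zero] at h
        exact h.symm }
  have hmemU : ∀ g, g ∈ U ↔ ρ g = 1 ∧ w.1 g = 0 := fun g => Iff.rfl
  haveI : U.Normal := ⟨fun n hn g => by
    rw [hmemU] at hn ⊢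
    have hginv : ρ g * ρ g⁻¹ = 1 := by rw [← map_mul, mul_inv_cancel, map_one]
    refine ⟨by rw [map_mul, map_mul, hn.1, mul_one, hginv], ?_⟩
    have h2 : w.1 (n * g⁻¹) = w.1 g⁻¹ := by
      rw [hcoc, hn.2, zero_add, hn.1, Module.End.one_apply]
    have h3 : w.1 (g * g⁻¹) = w.1 g + ρ g (w.1 g⁻¹) := hcoc g g⁻¹
    rw [mul_inv_cancel, h1] at h3
    rw [mul_assoc, hcoc, h2]
    exact h3.symm⟩
  have hUopen : IsOpen (U : Set (absoluteGaloisGroup F)) := by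
    have hset : (U : Set (absoluteGaloisGroup F)) =
        (ρ.ker : Set (absoluteGaloisGroup F)) ∩ w.1 ⁻¹' {0} := by
      ext g
      rw [SetLike.mem_coe, hmemU, Set.mem_inter_iff, SetLike.mem_coe, Set.mem_preimage,
        Set.mem_singleton_iff]
      exact Iff.rfl
    rw [hset]
    exact (InflRes.isOpen_ker_of_finite ρ).inter (w.1.continuous.isOpen_preimage _ (isOpen_discrete _))
  have hIU : absInertia F ≤ U := fun τ hτ => (hmemU τ).mpr ⟨hI τ hτ, hw τ hτ⟩
  have hgen : ∀ q : absoluteGaloisGroup F ⧸ U, ∃ i : ℕ,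
      q = (QuotientGroup.mk φ : absoluteGaloisGroup F ⧸ U) ^ i :=
    fun q => exists_pow_eq_mk F hUopen hIU (IsAbsArithFrob.isFrobPow_holds hφ) q
  refine contOneCocycles.eq_zero_of_apply_eq_zero φ U hgen w (fun σ h hh => ?_) hwφ
  rw [hcoc, ((hmemU h).mp hh).2, map_zero, add_zero]

/-- **Rubin PCMI Prop. 1.4.13 (1), injectivity: an unramified cocycle whose value at an arithmetic
Frobenius is a `φ`-coboundary value `φ m − m` is a coboundary** (`z − ∂m` vanishes on inertia and
at `φ`). [cite: Rubin2011, Prop. 1.4.13 (1) (p. 9)] [cite: MazurRubin2004, Lemma 1.2.1 (i)] -/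
theorem oneCocycleClass_eq_zero_of_apply_frob_eq (hI : ∀ τ ∈ absInertia F, ρ τ = 1)
    {φ : absoluteGaloisGroup F} (hφ : IsAbsArithFrob φ) (z : contOneCocycles ρ.toTopRep)
    (hz : ∀ τ ∈ absInertia F, z.1 τ = 0) {m : M} (hm : z.1 φ = ρ φ m - m) :
    oneCocycleClass ρ.toTopRep z = 0 := by
  set w : contOneCocycles ρ.toTopRep := z - coboundaryCocycle ρ m with hwdef
  have hwapp : ∀ g, w.1 g = z.1 g - (ρ g m - m) := fun g => by
    rw [hwdef, Submodule.coe_sub, ContinuousMap.sub_apply, coboundaryCocycle_apply]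
  have hw0 : w = 0 := by
    refine cocycle_eq_zero_of_apply_frob_eq_zero ρ hI hφ w (fun τ hτ => ?_) ?_
    · rw [hwapp, hz τ hτ, hI τ hτ, Module.End.one_apply, sub_self, sub_zero]
    · rw [hwapp, hm, sub_self]
  have h : z = w + coboundaryCocycle ρ m := by rw [hwdef]; abel
  rw [h, oneCocycleClass_add, hw0, oneCocycleClass_zero, zero_add, oneCocycleClass_coboundaryCocycle]

variable (p : ℕ) [Fact p.Prime] [Module (ZMod p) M] [Module.Free (ZMod p) M] [Module.Finite (ZMod p) M]

omit [Finite M] in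
/-- **`φ^{fs}` is injective on `H¹_ur(F, M)`** ([MR04] Lemma 1.2.3 / Rubin Ex. 1.9.7, injectivity
half) for `M` free over `𝔽_p`, unramified, with `M/(φ − 1)M ≃ ℤ/p`, and ANY comparison map `fs`
satisfying `IsFiniteSingularComparisonWith ρ p fs φ τ` (the predicate characterising the canonical
map; `τ` plays no role here): `fs [z] = 0 ⟹ Q(φ⁻¹) z(φ) = 0 ⟹ z(φ) ∈ (φ − 1)M ⟹ [z] = 0`.
[cite: MazurRubin2004, Lemma 1.2.3 (p. 10–11)] [cite: Rubin2011, Exercise 1.9.7 (p. 15)] -/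
theorem injective_fs_of_isFiniteSingularComparisonWith (hI : ∀ τ ∈ absInertia F, ρ τ = 1)
    {φ τ : absoluteGaloisGroup F} (hφ : IsAbsArithFrob φ)
    (hcok : Nonempty (Literature.NumberTheory.GaloisCohomology.cokerSubOne ρ φ ≃+ ZMod p))
    {fs : galoisCohomology ρ 1 →+ ρ.SingularQuotient}
    (h : ρ.IsFiniteSingularComparisonWith p fs φ τ) :
    Function.Injective fun x : unramifiedSubgroup ρ 1 => fs (x : galoisCohomology ρ 1) := by
  haveI : Finite M := Module.finite_of_finite (ZMod p)
  have hI' : ∀ τ ∈ absInertia F, ∀ w : M, ρ τ w = w := fun τ hτ w => by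
    rw [hI τ hτ, Module.End.one_apply]
  -- kernel triviality
  have hker : ∀ x : unramifiedSubgroup ρ 1, fs (x : galoisCohomology ρ 1) = 0 → x = 0 := by
    intro x hx
    obtain ⟨z, hz⟩ := oneCocycleClass_surjective ρ.toTopRep (x : galoisCohomology ρ 1)
    have hzur : oneCocycleClass ρ.toTopRep z ∈ unramifiedSubgroup ρ 1 := by rw [hz]; exact x.2
    have hz0 : ∀ τ ∈ absInertia F, z.1 τ = 0 :=
      (X11b.LocBridge.mem_unramifiedSubgroup_one_iff_forall_eq_zero ρ hI' z).mp hzur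
    -- the representative `w = 0` of `fs [z] = 0`
    have happ := h.apply_eq z 0 hzur (by rw [singularMap_oneCocycleClass_zero, hz, hx])
    have hQ : ρ.comparisonOp p φ (z.1 φ) = 0 := by rw [← happ]; rfl
    obtain ⟨m, hm⟩ := mem_range_of_comparisonOp_eq_zero ρ p φ hcok (z.1 φ) hQ
    have hm' : z.1 φ = ρ φ m - m := by
      rw [← hm, AddMonoidHom.sub_apply, LinearMap.toAddMonoidHom_coe, AddMonoidHom.id_apply]
    have hcl := oneCocycleClass_eq_zero_of_apply_frob_eq ρ hI hφ z hz0 hm'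
    apply Subtype.ext
    rw [← hz, hcl]
    rfl
  intro x y hxy
  have hsub : fs ((x - y : unramifiedSubgroup ρ 1) : galoisCohomology ρ 1) = 0 := by
    rw [AddSubgroup.coe_sub, map_sub, sub_eq_zero]
    exact hxy
  exact sub_eq_zero.mp (hker _ hsub)

end Local

end Summit.BirchSwinnertonDyer.Rank1Residual.GaloisImage.FSComp

end
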